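import Summits.KontsevichZagierPeriods.KontsevichZagierPeriods.Theorems.RealOnePeriodRelations.Negative.Kit
import Summits.KontsevichZagierPeriods.KontsevichZagierPeriods.Theorems.HermiteRigidityGenusTwoCycleTransferPushforwardDimOne
import Summits.KontsevichZagierPeriods.KontsevichZagierPeriods.Theorems.HermiteRigidityGenusTwoCycleTransferSemialgebraicInvFunOn
import Literature.NumberTheory.Transcendental.SemialgebraicDerivativeProofs
import Literature.NumberTheory.Transcendental.SemialgebraicLineDeriv
import Summits.KontsevichZagierPeriods.KontsevichZagierPeriods.Theorems.SymplecticScissorsRealOnePeriodRelationsStubRetractionAlgebra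

/-!
# `RealOnePeriodRelations` (stmt-KontsevichZagierPeriods-10042), line `nash-retraction-thin-strip`:
# stub `stub_exactDimOne` — exact forms in dimension one without Newton–Leibniz

For `u : ℝ → ℝ` which is `ℚ`-semialgebraic and `C¹` on `[0,1]`, and representations
`r = [∫_{(0,1)} u′(t) dt]`, `r' = [∫_{(0,1)} (u 1 − u 0) dt]`, we show `[r] − [r'] ∈ M₁`, where
`M₁ = closure (1a ∪ 1b ∪ 2 ∪ Green)` contains NO Newton–Leibniz move. The proof uses only rules
1b (additivity of the integrand) and 2 (change of variables), through the "shear trick": pick a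
natural number `N > sup |u′|`; then `Φ(t) = N t + u(t)` is a strictly increasing `ℚ`-semialgebraic
`C¹` diffeomorphism of `(0,1)` onto `(u 0, N + u 1)` with `Φ′ = N + u′ > 0`, so rule 2 gives
`[∫_{(0,1)} (u′ + N)] ∼ [∫_{(u 0, N + u 1)} 1]`, while the affine map `A(t) = u 0 + (N + u 1 − u 0) t`
gives `[∫_{(0,1)} (u 1 − u 0 + N)] ∼ [∫_{(u 0, N + u 1)} 1]`; subtracting `[∫_{(0,1)} N]` from both
(rule 1b) yields `[∫ u′] ∼ [∫ (u 1 − u 0)]`. No monotonicity pieces, breakpoints or Green instance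
are needed.

References: M. Kontsevich, D. Zagier, *Periods* (2001), §1.2 rules (1), (2); J. Bochnak, M. Coste,
M.-F. Roy, *Real Algebraic Geometry* (1998), §2.2.
-/

noncomputable section

open Set MeasureTheory
open Literature.NumberTheory.Transcendental
open Literature.ModelTheory.ExponentialFields (IsSemialgebraic)
open Summit.KontsevichZagierPeriods.SymplecticScissors.RealOnePeriodRelationsNegative
  (M₁ unitDom isSemialgebraic_unitDom volume_unitDom)
open Summit.KontsevichZagierPeriods.HermiteRigidity.GenusTwoCycleTransfer
  (stub_pushforwardDimOne stub_semialgebraicInvFunOn)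

namespace Summit.KontsevichZagierPeriods.SymplecticScissors.RealOnePeriodRelations

namespace ExactDimOne

/-! ## Membership in `M₁` from the move sets -/

/-! ## Small constructions of representations (as existence statements) -/

/-- The representation `[∫_σ (f + N)]` obtained from `r = [∫_σ f]` by adding a natural-number
constant to the integrand (finite-volume domain). [folklore] -/
theorem exists_addNat (r : KZ.IntegralRep 1) (N : ℕ) (hvol : volume r.domain ≠ ⊤) :
    ∃ s : KZ.IntegralRep 1, s.domain = r.domain ∧ s.integrand = fun z => r.integrand z + N :=
  ⟨⟨r.domain, fun z => r.integrand z + N, r.isSemialgebraic_domain,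
    r.isSemialgebraicFunOn_integrand.fun_add
      (isSemialgebraicFunOn_const_natCast r.isSemialgebraic_domain N),
    r.integrableOn.add (integrableOn_const hvol)⟩, rfl, rfl⟩

/-- The constant representation `[∫_{(0,1)} N]` of a natural number. [folklore] -/
theorem exists_natRep (N : ℕ) :
    ∃ s : KZ.IntegralRep 1, s.domain = {z | z 0 ∈ Ioo (0 : ℝ) 1} ∧ s.integrand = fun _ => (N : ℝ) :=
  ⟨⟨unitDom, fun _ => (N : ℝ), isSemialgebraic_unitDom,
    isSemialgebraicFunOn_const_natCast isSemialgebraic_unitDom N,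
    integrableOn_const (by rw [volume_unitDom]; exact ENNReal.one_ne_top)⟩, rfl, rfl⟩

/-- The zero representation on the domain of `s`. [folklore] -/
theorem exists_zeroOn (s : KZ.IntegralRep 1) :
    ∃ z : KZ.IntegralRep 1, z.domain = s.domain ∧ z.integrand = fun _ => 0 :=
  ⟨⟨s.domain, fun _ => 0, s.isSemialgebraic_domain,
    by simpa using isSemialgebraicFunOn_const_natCast s.isSemialgebraic_domain 0,
    integrableOn_zero⟩, rfl, rfl⟩

/-- (P2) Two representations with the same domain whose integrands agree on it differ by an
element of `M₁` (rule 1b against the zero representation, which is itself a 1b-move).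
[cite: KontsevichZagier2001, §1.2 rule (1)] -/
theorem sub_mem_M₁_of_eqOn (s₁ s₂ : KZ.IntegralRep 1) (hdom : s₁.domain = s₂.domain)
    (hint : ∀ z ∈ s₁.domain, s₁.integrand z = s₂.integrand z) : KZ.of s₁ - KZ.of s₂ ∈ M₁ := by
  obtain ⟨z, hzdom, hzint⟩ := exists_zeroOn s₁
  have h1 : KZ.of s₁ - KZ.of s₂ - KZ.of z ∈ M₁ :=
    RetractionAlgebra.mem_M₁_of_mem_integrandAddRel ⟨1, s₁, s₂, z, hdom.symm, hzdom, fun x hx => by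
      simp [hzint, hint x hx], rfl⟩
  have h2 : KZ.of z - KZ.of z - KZ.of z ∈ M₁ :=
    RetractionAlgebra.mem_M₁_of_mem_integrandAddRel ⟨1, z, z, z, rfl, rfl, fun x _ => by simp [hzint], rfl⟩
  rw [sub_self, zero_sub] at h2
  have h3 := M₁.neg_mem h2
  rw [neg_neg] at h3
  have h4 := M₁.add_mem h1 h3
  rwa [sub_add_cancel] at h4

/-! ## Elementary facts on `ℝ¹` -/

/-- The coordinate `p ↦ p 0` is `ℚ`-semialgebraic on every `ℚ`-semialgebraic set. [folklore] -/
theorem isSemialgebraicFunOn_coord {s : Set (Fin 1 → ℝ)} (hs : IsSemialgebraic ℚ s) :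
    IsSemialgebraicFunOn ℚ s (fun p : Fin 1 → ℝ => p 0) :=
  (isSemialgebraicFunOn_aeval hs (MvPolynomial.X 0 : MvPolynomial (Fin 1) ℚ)).congr
    fun x _ => by simp

/-- The value of a `ℚ`-semialgebraic function on `[0,1]` at a natural-number point of `[0,1]` is a
`ℚ`-semialgebraic constant (composition with a constant semialgebraic map).
[cite: BochnakCosteRoy1998, Prop. 2.2.6] -/
theorem isSemialgebraicFunOn_const_apply {u : ℝ → ℝ}
    (hu : IsSemialgebraicFunOn ℚ {z : Fin 1 → ℝ | z 0 ∈ Icc (0 : ℝ) 1} (fun z => u (z 0)))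
    {s : Set (Fin 1 → ℝ)} (hs : IsSemialgebraic ℚ s) (n : ℕ) (hn : (n : ℝ) ≤ 1) :
    IsSemialgebraicFunOn ℚ s (fun _ => u n) := by
  have hc : IsSemialgebraicMapOn ℚ s (fun (_ : Fin 1 → ℝ) (_ : Fin 1) => (n : ℝ)) :=
    IsSemialgebraicMapOn.of_forall hs fun _ => isSemialgebraicFunOn_const_natCast hs n
  have hmaps : MapsTo (fun (_ : Fin 1 → ℝ) (_ : Fin 1) => (n : ℝ)) s
      {z : Fin 1 → ℝ | z 0 ∈ Icc (0 : ℝ) 1} :=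
    fun _ _ => ⟨n.cast_nonneg, hn⟩
  exact IsSemialgebraicFunOn.comp_isSemialgebraicMapOn_holds hu hc hmaps

/-- Lifting images to `ℝ¹`: the image of `{z | z 0 ∈ S}` under `p ↦ (f (p 0))` is
`{z | z 0 ∈ f '' S}`. [folklore] -/
theorem image_fin_one (f : ℝ → ℝ) (S : Set ℝ) :
    (fun p : Fin 1 → ℝ => fun _ : Fin 1 => f (p 0)) '' {z | z 0 ∈ S} = {z | z 0 ∈ f '' S} := by
  ext z
  simp only [mem_image, mem_setOf_eq]
  constructor
  · rintro ⟨p, hp, rfl⟩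
    exact ⟨p 0, hp, rfl⟩
  · rintro ⟨t, ht, hz⟩
    refine ⟨fun _ => t, ht, ?_⟩
    funext i
    rw [Subsingleton.elim i 0]
    exact hz

/-- A continuous strictly increasing function on `[0,1]` maps `(0,1)` onto `(f 0, f 1)`
(intermediate value theorem). [folklore] -/
theorem image_Ioo_eq {f : ℝ → ℝ} (hc : ContinuousOn f (Icc 0 1)) (hm : StrictMonoOn f (Icc 0 1)) :
    f '' Ioo 0 1 = Ioo (f 0) (f 1) := by
  refine Subset.antisymm ?_ (intermediate_value_Ioo zero_le_one hc)
  rintro _ ⟨t, ht, rfl⟩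
  exact ⟨hm (left_mem_Icc.2 zero_le_one) (Ioo_subset_Icc_self ht) ht.1,
    hm (Ioo_subset_Icc_self ht) (right_mem_Icc.2 zero_le_one) ht.2⟩

/-! ## Rule 2 along an increasing diffeomorphism of `(0,1)` -/

/-- **Push-forward of `[∫_{(0,1)} φ′]` along `φ`.** If `r = [∫_{(0,1)} φ′]` with `φ`
`ℚ`-semialgebraic, continuous and strictly increasing on `[0,1]`, differentiable on `(0,1)` with
`ℚ`-semialgebraic derivative `φ′ > 0`, then rule 2 with `Φ = φ` yields a representation
`s = [∫_{(φ 0, φ 1)} 1]` with `[r] − [s] ∈ changeOfVariablesRel`.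
[cite: KontsevichZagier2001, §1.2 rule (2)] -/
theorem push (r : KZ.IntegralRep 1) (hr : r.domain = {z | z 0 ∈ Ioo (0 : ℝ) 1}) (φ φ' : ℝ → ℝ)
    (a b : ℝ) (ha : φ 0 = a) (hb : φ 1 = b)
    (hφ : IsSemialgebraicFunOn ℚ {z : Fin 1 → ℝ | z 0 ∈ Ioo (0 : ℝ) 1} (fun p => φ (p 0)))
    (hφ' : IsSemialgebraicFunOn ℚ {z : Fin 1 → ℝ | z 0 ∈ Ioo (0 : ℝ) 1} (fun p => φ' (p 0)))
    (hcont : ContinuousOn φ (Icc 0 1)) (hmono : StrictMonoOn φ (Icc 0 1))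
    (hder : ∀ t ∈ Ioo (0 : ℝ) 1, HasDerivAt φ (φ' t) t) (hpos : ∀ t ∈ Ioo (0 : ℝ) 1, 0 < φ' t)
    (hint : ∀ p ∈ r.domain, r.integrand p = φ' (p 0)) :
    ∃ s : KZ.IntegralRep 1, s.domain = {z | z 0 ∈ Ioo a b} ∧ (∀ z ∈ s.domain, s.integrand z = 1) ∧
      KZ.of r - KZ.of s ∈ KZ.changeOfVariablesRel := by
  have hmem : ∀ p ∈ r.domain, p 0 ∈ Ioo (0 : ℝ) 1 := fun p hp => by
    rw [hr] at hp
    exact hp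
  have hφr : IsSemialgebraicFunOn ℚ r.domain (fun p => φ (p 0)) := by
    rw [hr]
    exact hφ
  have hφ'r : IsSemialgebraicFunOn ℚ r.domain (fun p => φ' (p 0)) := by
    rw [hr]
    exact hφ'
  have hinj : InjOn (fun p : Fin 1 → ℝ => fun _ : Fin 1 => φ (p 0)) r.domain := by
    intro p hp q hq hpq
    have h0 := congr_fun hpq 0
    dsimp only at h0
    have h1 : p 0 = q 0 :=
      hmono.injOn (Ioo_subset_Icc_self (hmem p hp)) (Ioo_subset_Icc_self (hmem q hq)) h0
    funext i
    rw [Subsingleton.elim i 0]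
    exact h1
  have hΦsa : IsSemialgebraicMapOn ℚ r.domain (fun p : Fin 1 → ℝ => fun _ : Fin 1 => φ (p 0)) :=
    IsSemialgebraicMapOn.of_forall r.isSemialgebraic_domain fun _ => hφr
  have hG := stub_semialgebraicInvFunOn hΦsa hinj
  have hGΦ : ∀ p ∈ r.domain,
      Function.invFunOn (fun p : Fin 1 → ℝ => fun _ : Fin 1 => φ (p 0)) r.domain
        (fun _ => φ (p 0)) = p :=
    fun p hp => hinj.leftInvOn_invFunOn hp
  obtain ⟨s, hsdom, hsint, hrel⟩ := stub_pushforwardDimOne r φ φ' _ hφr hφ'r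
    (fun p hp => hder _ (hmem p hp)) (fun p hp => (hpos _ (hmem p hp)).ne') hG hGΦ
  refine ⟨s, ?_, ?_, hrel⟩
  · rw [hsdom, hr, image_fin_one, image_Ioo_eq hcont hmono, ha, hb]
  · intro z hz
    rw [hsdom] at hz
    obtain ⟨p, hp, rfl⟩ := hz
    rw [hsint p hp, hint p hp, abs_of_pos (hpos _ (hmem p hp)),
      div_self (hpos _ (hmem p hp)).ne']

end ExactDimOne

open ExactDimOne in
/-- **Stub `stub_exactDimOne`.** EXACT FORMS IN DIMENSION ONE: for `u` `ℚ`-semialgebraic and `C¹`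
on `[0,1]`, `[∫₀¹ u′(t) dt] − [∫₀¹ (u(1) − u(0)) dt] ∈ M₁`, using only rules 1b and 2: with a
natural number `N > sup |u′|`, the shear `Φ(t) = N t + u(t)` and the affine map
`A(t) = u 0 + (N + u 1 − u 0) t` both push `(0,1)` forward onto `(u 0, N + u 1)` with unit
density, from `[∫ (u′ + N)]` and `[∫ (u 1 − u 0 + N)]` respectively.
[cite: KontsevichZagier2001, §1.2 rules (1), (2)] -/
theorem stub_exactDimOne : ∀ (u : ℝ → ℝ),
    IsSemialgebraicFunOn ℚ {z : Fin 1 → ℝ | z 0 ∈ Set.Icc (0 : ℝ) 1} (fun z => u (z 0)) →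
    ContDiffOn ℝ 1 u (Set.Icc (0 : ℝ) 1) →
    ∀ (r r' : KZ.IntegralRep 1), r.domain = {z | z 0 ∈ Set.Ioo (0 : ℝ) 1} → r'.domain = {z | z 0 ∈ Set.Ioo (0 : ℝ) 1} →
      (∀ z ∈ r.domain, r.integrand z = deriv u (z 0)) → (∀ z ∈ r'.domain, r'.integrand z = u 1 - u 0) →
      KZ.of r - KZ.of r' ∈ M₁ := by
  intro u hu hu1 r r' hr hr' hint hint'
  -- derivative of `u` on `(0,1)` and a natural bound `N > |u′|`
  have hdiff : DifferentiableOn ℝ u (Icc 0 1) := hu1.differentiableOn one_ne_zero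
  have hdu : ∀ t ∈ Ioo (0 : ℝ) 1, HasDerivAt u (deriv u t) t := fun t ht =>
    ((hdiff t (Ioo_subset_Icc_self ht)).differentiableAt (Icc_mem_nhds ht.1 ht.2)).hasDerivAt
  have hcdw : ContinuousOn (derivWithin u (Icc 0 1)) (Icc 0 1) :=
    hu1.continuousOn_derivWithin (uniqueDiffOn_Icc zero_lt_one) le_rfl
  obtain ⟨C, hC⟩ := isCompact_Icc.exists_bound_of_continuousOn hcdw
  obtain ⟨N, hCN⟩ := exists_nat_gt C
  have hbound : ∀ t ∈ Ioo (0 : ℝ) 1, |deriv u t| < N := fun t ht => by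
    have h1 := hC t (Ioo_subset_Icc_self ht)
    rw [derivWithin_of_mem_nhds (Icc_mem_nhds ht.1 ht.2), Real.norm_eq_abs] at h1
    exact h1.trans_lt hCN
  have hpos : ∀ t ∈ Ioo (0 : ℝ) 1, 0 < (N : ℝ) + deriv u t := fun t ht => by
    have h1 := (abs_lt.1 (hbound t ht)).1
    linarith
  -- the shear `Φ(t) = N t + u t`
  have hΦder : ∀ t ∈ Ioo (0 : ℝ) 1,
      HasDerivAt (fun t => (N : ℝ) * t + u t) ((N : ℝ) + deriv u t) t := fun t ht =>
    (((hasDerivAt_id' t).const_mul (N : ℝ)).add (hdu t ht)).congr_deriv (by rw [mul_one])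
  have hΦcont : ContinuousOn (fun t => (N : ℝ) * t + u t) (Icc 0 1) :=
    (continuousOn_const.mul continuousOn_id).add hu1.continuousOn
  have hΦmono : StrictMonoOn (fun t => (N : ℝ) * t + u t) (Icc 0 1) :=
    strictMonoOn_of_deriv_pos (convex_Icc 0 1) hΦcont fun t ht => by
      rw [interior_Icc] at ht
      rw [(hΦder t ht).deriv]
      exact hpos t ht
  have hNpos : 0 < (N : ℝ) + u 1 - u 0 := by
    have h1 := hΦmono (left_mem_Icc.2 zero_le_one) (right_mem_Icc.2 zero_le_one) zero_lt_one
    simp only [mul_zero, zero_add, mul_one] at h1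
    linarith
  -- semialgebraicity of `Φ`, `Φ′` and of the affine data on `I = (0,1)`
  have hI : IsSemialgebraic ℚ {z : Fin 1 → ℝ | z 0 ∈ Ioo (0 : ℝ) 1} := isSemialgebraic_unitDom
  have huI : IsSemialgebraicFunOn ℚ {z : Fin 1 → ℝ | z 0 ∈ Ioo (0 : ℝ) 1} (fun p => u (p 0)) :=
    hu.mono (fun z hz => Ioo_subset_Icc_self hz) hI
  have hΦsa : IsSemialgebraicFunOn ℚ {z : Fin 1 → ℝ | z 0 ∈ Ioo (0 : ℝ) 1}
      (fun p => (N : ℝ) * p 0 + u (p 0)) :=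
    ((isSemialgebraicFunOn_const_natCast hI N).fun_mul (isSemialgebraicFunOn_coord hI)).fun_add huI
  have hdusa : IsSemialgebraicFunOn ℚ {z : Fin 1 → ℝ | z 0 ∈ Ioo (0 : ℝ) 1}
      (fun p => deriv u (p 0)) :=
    IsSemialgebraicFunOn.hasDerivAt_isSemialgebraic_holds 0 1 u (deriv u) zero_lt_one huI hdu
  have hΦ'sa : IsSemialgebraicFunOn ℚ {z : Fin 1 → ℝ | z 0 ∈ Ioo (0 : ℝ) 1}
      (fun p => (N : ℝ) + deriv u (p 0)) :=
    (isSemialgebraicFunOn_const_natCast hI N).fun_add hdusa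
  have h0 : IsSemialgebraicFunOn ℚ {z : Fin 1 → ℝ | z 0 ∈ Ioo (0 : ℝ) 1} (fun _ => u 0) := by
    simpa using isSemialgebraicFunOn_const_apply hu hI 0 (by norm_num)
  have h1 : IsSemialgebraicFunOn ℚ {z : Fin 1 → ℝ | z 0 ∈ Ioo (0 : ℝ) 1} (fun _ => u 1) := by
    simpa using isSemialgebraicFunOn_const_apply hu hI 1 (by norm_num)
  have hA'sa : IsSemialgebraicFunOn ℚ {z : Fin 1 → ℝ | z 0 ∈ Ioo (0 : ℝ) 1}
      (fun _ => (N : ℝ) + u 1 - u 0) :=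
    ((isSemialgebraicFunOn_const_natCast hI N).fun_add h1).fun_sub h0
  have hAsa : IsSemialgebraicFunOn ℚ {z : Fin 1 → ℝ | z 0 ∈ Ioo (0 : ℝ) 1}
      (fun p => u 0 + ((N : ℝ) + u 1 - u 0) * p 0) :=
    h0.fun_add (hA'sa.fun_mul (isSemialgebraicFunOn_coord hI))
  -- the affine map `A(t) = u 0 + (N + u 1 - u 0) t`
  have hAder : ∀ t ∈ Ioo (0 : ℝ) 1,
      HasDerivAt (fun t => u 0 + ((N : ℝ) + u 1 - u 0) * t) ((N : ℝ) + u 1 - u 0) t :=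
    fun t _ => (((hasDerivAt_id' t).const_mul _).const_add _).congr_deriv (mul_one _)
  have hAcont : ContinuousOn (fun t => u 0 + ((N : ℝ) + u 1 - u 0) * t) (Icc 0 1) :=
    continuousOn_const.add (continuousOn_const.mul continuousOn_id)
  have hAmono : StrictMonoOn (fun t => u 0 + ((N : ℝ) + u 1 - u 0) * t) (Icc 0 1) :=
    fun x _ y _ hxy => by
      show u 0 + ((N : ℝ) + u 1 - u 0) * x < u 0 + ((N : ℝ) + u 1 - u 0) * y
      linarith [mul_lt_mul_of_pos_left hxy hNpos]
  -- the representations `[∫ (u′ + N)]`, `[∫ (u 1 − u 0 + N)]`, `[∫ N]` on `(0,1)`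
  have hvol : volume r.domain ≠ ⊤ := by
    rw [hr]
    show volume unitDom ≠ ⊤
    rw [volume_unitDom]
    exact ENNReal.one_ne_top
  have hvol' : volume r'.domain ≠ ⊤ := by
    rw [hr']
    show volume unitDom ≠ ⊤
    rw [volume_unitDom]
    exact ENNReal.one_ne_top
  obtain ⟨rΦ, hrΦdom, hrΦint⟩ := exists_addNat r N hvol
  obtain ⟨rA, hrAdom, hrAint⟩ := exists_addNat r' N hvol'
  obtain ⟨cN, hcNdom, hcNint⟩ := exists_natRep N
  -- rule 2 along `Φ`: `[∫_{(0,1)} (u′ + N)] ∼ [∫_{(u 0, N + u 1)} 1]`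
  obtain ⟨s₁, hs₁dom, hs₁int, hs₁rel⟩ := push rΦ (hrΦdom.trans hr) (fun t => (N : ℝ) * t + u t)
    (fun t => (N : ℝ) + deriv u t) (u 0) (N + u 1) (by simp) (by simp) hΦsa hΦ'sa hΦcont hΦmono
    hΦder hpos (fun p hp => by
      rw [hrΦdom] at hp
      rw [hrΦint]
      dsimp only
      rw [hint p hp, add_comm])
  -- rule 2 along `A`: `[∫_{(0,1)} (u 1 − u 0 + N)] ∼ [∫_{(u 0, N + u 1)} 1]`
  obtain ⟨s₂, hs₂dom, hs₂int, hs₂rel⟩ := push rA (hrAdom.trans hr')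
    (fun t => u 0 + ((N : ℝ) + u 1 - u 0) * t) (fun _ => (N : ℝ) + u 1 - u 0) (u 0) (N + u 1)
    (by simp) (by show u 0 + ((N : ℝ) + u 1 - u 0) * 1 = N + u 1; ring) hAsa hA'sa hAcont hAmono
    hAder (fun _ _ => hNpos) (fun p hp => by
      rw [hrAdom] at hp
      rw [hrAint]
      dsimp only
      rw [hint' p hp]
      ring)
  -- the two push-forwards coincide
  have hdom : s₁.domain = s₂.domain := hs₁dom.trans hs₂dom.symm
  have h5 : KZ.of s₁ - KZ.of s₂ ∈ M₁ :=
    sub_mem_M₁_of_eqOn s₁ s₂ hdom fun z hz => by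
      rw [hs₁int z hz, hs₂int z (hdom ▸ hz)]
  -- rule 1b: subtract the constant `N`
  have h1b : KZ.of rΦ - KZ.of r - KZ.of cN ∈ M₁ :=
    RetractionAlgebra.mem_M₁_of_mem_integrandAddRel ⟨1, rΦ, r, cN, hrΦdom.symm, hcNdom.trans (hrΦdom.trans hr).symm,
      fun x _ => by simp [hrΦint, hcNint], rfl⟩
  have h1b' : KZ.of rA - KZ.of r' - KZ.of cN ∈ M₁ :=
    RetractionAlgebra.mem_M₁_of_mem_integrandAddRel ⟨1, rA, r', cN, hrAdom.symm, hcNdom.trans (hrAdom.trans hr').symm,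
      fun x _ => by simp [hrAint, hcNint], rfl⟩
  have h2 := RetractionAlgebra.mem_M₁_of_mem_changeOfVariablesRel hs₁rel
  have h4 := RetractionAlgebra.mem_M₁_of_mem_changeOfVariablesRel hs₂rel
  have key : KZ.of r - KZ.of r' =
      -(KZ.of rΦ - KZ.of r - KZ.of cN) + (KZ.of rΦ - KZ.of s₁) + (KZ.of s₁ - KZ.of s₂) -
        (KZ.of rA - KZ.of s₂) + (KZ.of rA - KZ.of r' - KZ.of cN) := by
    abel
  rw [key]
  exact M₁.add_mem (M₁.sub_mem (M₁.add_mem (M₁.add_mem (M₁.neg_mem h1b) h2) h5) h4) h1b'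

end Summit.KontsevichZagierPeriods.SymplecticScissors.RealOnePeriodRelations

end
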